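import Summits.BirchSwinnertonDyer.BirchSwinnertonDyer.Theses.SignedLowerHalves
import Summits.BirchSwinnertonDyer.BirchSwinnertonDyer.Theorems.SignedLowerHalvesSprungLowerDivisibilityAtThreeIotaDoorStubs
import Summits.BirchSwinnertonDyer.BirchSwinnertonDyer.Theorems.SignedLowerHalvesSprungLowerDivisibilityAtThreeKatoSporadicLedgerX8
import Summits.BirchSwinnertonDyer.BirchSwinnertonDyer.Theorems.SignedLowerHalvesSprungLowerDivisibilityAtThreeIotaSharpRow
import Summits.BirchSwinnertonDyer.BirchSwinnertonDyer.Theorems.SignedLowerHalvesSprungLowerDivisibilityAtThreeCyclotomicPosLevelLedgerOrbit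
import Literature.NumberTheory.EllipticCurves.CyclotomicIwasawaMainTheoremIrreducibleProofs
import HarnessLib

/-!
# Negative lemma for the crux `SprungLowerDivisibilityAtThree` (item stmt-BirchSwinnertonDyer-19875): the TYPED crux is
# refuted by ONE X8 pair carrying (a tree-keyed dual, a naturally-keyed dual with Kato's divisibility, the keying dictionary
# between them, and a private sporadic zero of `L♯`) — the KEYING ALARM R-228 / T67 («P5 TRUE») read on the K1 leaf itself

Cell `bsd-ssimc` (host), LEAD seat `cruxlead-stmt-BirchSwinnertonDyer-19875` (gen 5); `--negative-modulo KeyedSharpPrivateZero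
--supports stmt-BirchSwinnertonDyer-19875`; one `def … : Prop` (the hypothesis `H`, a pure ∃-package, nothing asserted) and one
theorem `SprungLowerDivisibilityAtThree_false_of_KeyedSharpPrivateZero : H → ¬ crux`. The item stays open; `H` is NOT
constructible in the tree today (its conjuncts (ii)–(iv) are nature's facts — print theorems and per-pair numerics — that the
tree cannot yet produce as objects); NOTHING here refutes Sprung's Main Conjecture 7.21: what is exposed is the KEYING of the
typed leaf. BSD / K1 / leaf X8 are neither proved nor refuted by this file.

THE POINT (x8 referee g23 `REF-G23-R228-KEYING.md` §0–§3 + x8 lit g52 `LIT-T67…` (i)/(j2)/(j3)/(m), 2026-08-28; read on the leaf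
by the LEAD). The K1 leaf `Theorems.SprungSharpFlatLowerDivisibility W p •` (the crux's conjunct per X8 pair and colour) is typed
over the binders of `Sprung2012.thm716_sharpFlatCharIdeal_divisibility` word for word: ONE `γ` with `IsCyclotomicVariable p γ`,
the Sprung pair `(L♯, L♭)` of the tree (`IsSprungPair`, Mazur–Tate orientation `1 + T ↔ γ`; in print `Col^•(z_Kato) = (L♯, L♭)`
VERBATIM, no `ι` — T67 (i)), and a dual datum `D : SharpFlatSelmerDualData W κ γ …` whose `Λ`-action is keyed by
PRE-composition with the covariant Galois action (`toDual_T_smul`; R-228 P1), i.e. — Tate / Poitou–Tate duality being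
`Λ`-linear only for the CONTRAGREDIENT action (R-228 P2) — `D.X ≅ (X^•_nat)^ι` as `Λ`-modules, where `X^•_nat` is the dual of
print's exact sequence (3) / Thm. 7.16 and `ι : T ↦ (1+T)⁻¹ − 1`. So the typed leaf says in nature «`ϖ·L^•` divides a
generator of `ι(char X^•_nat)`», i.e. «`ι(L^•) ∣ char X^•_nat`» — not Sprung's Main Conj. 7.21 ⊆ «`L^• ∣ char X^•_nat`». The
theorem below makes the consequence kernel-visible: GIVEN, for one X8 pair and `• = ♯`,
  (i) a tree-keyed (`γ`) dual `D` of `Sel♯`, finitely generated torsion (Sprung Thm. 7.14 — keying-immune);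
  (ii) a naturally-keyed (`γ⁻¹`) dual `D′` of `Sel♯`, f.g. torsion, with Kato's divisibility `pⁿ·L♯ ∈ char D′.X` — Sprung 2012
       Thm. 7.16 in PRINT keying (true in print; the tree's typed `thm716_…` is the `γ`-keyed transcription);
  (iii) the keying dictionary `ℓ_𝔭 D.X = ℓ_{ι𝔭} D′.X` at every height-one `𝔭` (R-228 P1/P2; the ♯/♭ twin «H1a» of the landed
       fine dictionary `Kato2004.fineSelmerDualData_lengthAt_inv_eq`; provable in the tree once the SharpFlat rigidity / twist
       lemmas are written — STUB-PLAN v3 k5-g2 H1a);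
  (iv) a PRIVATE SPORADIC ZERO of `L♯`: a height-one `𝔭₀ ∌ 3, T, Φ₃(1+T)` with `L♯ ∈ 𝔭₀`, `L♭ ∉ 𝔭₀` (generic on the x8
       census per R-228 §0 / ty3 data; a per-pair numerical certificate, not a tree object),
the typed crux is FALSE: the leaf gives `char D.X = (gen)` with `gen ≐ ϖ·L♯·h`, so `ℓ_{𝔭₀} D.X ≥ ℓ_{𝔭₀} Λ/(L♯) ≥ 1` (constants and
`h` only add); (iii) moves this to `ℓ_{ι𝔭₀} D′.X ≥ 1`; (ii) bounds `ℓ_{ι𝔭₀} D′.X ≤ ℓ_{ι𝔭₀} Λ/(pⁿ L♯) = ℓ_{ι𝔭₀} Λ/(L♯)`, so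
`L♯ ∈ ι𝔭₀`, i.e. `ι(L♯) ∈ 𝔭₀`; and on X8 «`L♯ ∈ 𝔭₀ ∧ ι(L♯) ∈ 𝔭₀ ⟹ L♭ ∈ 𝔭₀`» off the three primes is the input-free pair
functional equation (`ChromaticIota.ClassX8.mem_and_mem_iff_sharp_iotaPair`, R-221, p645xxx) — contradicting (iv). In words:
the typed K1 forces «no private sporadic zero of `L♯`» on every X8 pair, which the census denies; the print conjecture forces no
such thing. REPAIR (planners'/typers', recorded not enacted): key the duals contragrediently — `SharpFlatSelmerDualData W κ γ⁻¹ …`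
in the leaf / h716 / hJ (or re-key `toDual_T_smul` in Literature), equivalently `invol p (chromaticL • L♯ L♭)` in the leaf's
conclusion; under that reading (ii) IS the tree's h716 and the argument above is void (both sides at the same prime).

References: [Sprung2012] Thm. 7.14 (3), Thm. 7.16 (p. 1504), Main Conj. 7.21 (p. 1505), Def. 6.1 / Thm. 6.12 (pp. 1495–1498);
[Kato2004Asterisque] §5.5 (p. 156), Thm. 12.5 (p. 221), §17.13; [Sprung2017] Thm. 4.13, Cor. 4.10/4.14; [MazurTateTeitelbaum1986Invent]
Ch. I §17; [Greenberg1989] §0; x8 HOME `ref/REF-G23-R228-KEYING.md`, `LIT-T67-ASK1PRIME-ORIENTATION-KATO-SPRUNG-KEYING-COKERNEL-AT-THE-PAGE.md`;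
tree: `Theorems/SprungSharpFlatMainConjecture.lean` (:116–140), `Sprung2012/SharpFlatSelmer.lean` (`toDual_T_smul`),
`…IotaSharpRow` (R-221), `…KatoSporadicLedger` (length bookkeeping off `(p)`), `…KatoSporadicLedgerKato` (`comap_invol_heightOne_not_mem`).
-/

set_option autoImplicit false
-- the problem directory `BirchSwinnertonDyer/BirchSwinnertonDyer` forces the duplicated namespace segment
set_option linter.dupNamespace false

noncomputable section

open scoped Classical NumberField MatrixGroups ModularForm

open NumberField IsDedekindDomain CongruenceSubgroup WeierstrassCurve Field
  Literature.NumberTheory.EllipticCurves Literature.NumberTheory.EllipticCurves.ModularForms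
  Literature.NumberTheory.EllipticCurves.ZpExtension Literature.NumberTheory.EllipticCurves.Sprung2017
  Literature.NumberTheory.EllipticCurves.Sprung2012 Literature.NumberTheory.EllipticCurves.Rank1Residual
  Literature.NumberTheory.EllipticCurves.IwasawaAlgebra Literature.NumberTheory.EllipticCurves.Kato2004
  Literature.NumberTheory.EllipticCurves.Module Literature.Barriers.BirchSwinnertonDyer
  Summit.BirchSwinnertonDyer.BirchSwinnertonDyer.Theorems.SmallImageSignedMuDefect
  Summit.BirchSwinnertonDyer.BirchSwinnertonDyer.Theorems.ChromaticCommonZeros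

namespace Summit.BirchSwinnertonDyer.BirchSwinnertonDyer.Theorems

/-- **The hypothesis `H` of the negative lemma: ONE X8 pair with the keying witness for `♯`** (a pure `∃`-package; nothing
asserted; NOT constructible in the tree today). In the setting of the crux's own binders (X8 pair `(W, p)`, cyclotomic
`(κ, γ)` with `IsCyclotomicVariable p γ`, place `v ∣ p`, local lift `g`, Honda system `(cneg, c)`, newform `f`, period ratio `ϖ`,
Sprung pair `(L♯, L♭)`): (i) a tree-keyed dual datum `D : SharpFlatSelmerDualData W κ γ … ♯`, finitely generated torsion
(Sprung 2012 Thm. 7.14); (ii) a naturally (contragrediently) keyed dual datum `D′ : SharpFlatSelmerDualData W κ γ⁻¹ … ♯`,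
finitely generated torsion, with Kato's divisibility `pⁿ·L♯ ∈ char D′.X` for some `n` (Sprung 2012 Thm. 7.16 in print keying);
(iii) the keying dictionary `ℓ_𝔭 D.X = ℓ_{ι𝔭} D′.X` at every height-one `𝔭` (`ι𝔭 = PrimeSpectrum.comap (invol p) 𝔭`; R-228
P1/P2); (iv) a private sporadic zero of `L♯`: a height-one prime `𝔭₀` with `p, T, Φ₃(1+T) = (1+T)²+(1+T)+1 ∉ 𝔭₀`, `L♯ ∈ 𝔭₀`,
`L♭ ∉ 𝔭₀`. (Sources, prose only — this is a hypothesis package, not a citable fact: Sprung 2012 Thm. 7.14 / 7.16; Kato 2004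
Thm. 12.5; Greenberg 1989 §0 for `ι`; x8 R-228 / T67 for the keying.) -/
def KeyedSharpPrivateZero : Prop :=
  ∃ (W : WeierstrassCurve ℚ) (_ : W.IsElliptic) (_ : W.IsGloballyMinimal) (p : ℕ) (_ : Fact p.Prime)
    (_ : ClassX8 W p) (κ : ZpExtension ℚ p) (γ : Field.absoluteGaloisGroup ℚ)
    (_ : κ.IsCyclotomic) (_ : κ.IsTopGenerator γ) (_ : IsCyclotomicVariable p γ)
    (v : HeightOneSpectrum (𝓞 ℚ)) (_ : (p : 𝓞 ℚ) ∈ v.asIdeal)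
    (g : Field.absoluteGaloisGroup (v.adicCompletion ℚ))
    (_ : κ.IsTopGenerator (resGalOfEmb (closureEmb (K := ℚ) (v.adicCompletion ℚ)) g))
    (cneg : localPoints W (v.adicCompletion ℚ)) (c : ℕ → localPoints W (v.adicCompletion ℚ))
    (_ : IsHondaSystem κ (closureEmb (K := ℚ) (v.adicCompletion ℚ)) W (W.frobeniusTrace p) g cneg c)
    (N : ℕ) (_ : NeZero N) (f : CuspForm (Gamma0 N) 2) (ϖ : ℚ) (Lsharp Lflat : IwasawaAlgebra p)
    (_ : IsNewformOf W f) (_ : (ϖ : ℝ) * W.realPeriodRat = plusPeriod f)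
    (_ : IsSprungPair f p (W.frobeniusTrace p) Lsharp Lflat)
    -- (i) a tree-keyed dual of `Sel♯`, finitely generated torsion
    (D : SharpFlatSelmerDualData W κ γ (closureEmb (K := ℚ) (v.adicCompletion ℚ)) (W.frobeniusTrace p) g c
      Chroma.sharp)
    (_ : Module.Finite (IwasawaAlgebra p) D.X) (_ : Module.IsTorsion (IwasawaAlgebra p) D.X)
    -- (ii) a naturally keyed dual of `Sel♯`, finitely generated torsion, with Kato's divisibility in print keying
    (D' : SharpFlatSelmerDualData W κ γ⁻¹ (closureEmb (K := ℚ) (v.adicCompletion ℚ)) (W.frobeniusTrace p) g c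
      Chroma.sharp)
    (_ : Module.Finite (IwasawaAlgebra p) D'.X) (_ : Module.IsTorsion (IwasawaAlgebra p) D'.X)
    (_ : ∃ n : ℕ, (p : IwasawaAlgebra p) ^ n * Lsharp ∈ D'.charIdeal)
    -- (iii) the keying dictionary
    (_ : ∀ 𝔭 : PrimeSpectrum (IwasawaAlgebra p), 𝔭.asIdeal.height = 1 →
      Module.lengthAt (IwasawaAlgebra p) D.X 𝔭 =
        Module.lengthAt (IwasawaAlgebra p) D'.X (PrimeSpectrum.comap (invol p).toRingHom 𝔭))
    -- (iv) a private sporadic zero of `L♯`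
    (𝔭₀ : PrimeSpectrum (IwasawaAlgebra p)),
    𝔭₀.asIdeal.height = 1 ∧ (p : IwasawaAlgebra p) ∉ 𝔭₀.asIdeal ∧ (PowerSeries.X : IwasawaAlgebra p) ∉ 𝔭₀.asIdeal ∧
      ((1 + PowerSeries.X : IwasawaAlgebra p) ^ 2 + (1 + PowerSeries.X) + 1) ∉ 𝔭₀.asIdeal ∧
      Lsharp ∈ 𝔭₀.asIdeal ∧ Lflat ∉ 𝔭₀.asIdeal

/-- **NEGATIVE LEMMA: the keying witness refutes the TYPED crux.** `KeyedSharpPrivateZero → ¬ SprungLowerDivisibilityAtThree`.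
Chain at the witness pair, colour `♯`, private sporadic zero `𝔭₀`: the typed leaf at the tree-keyed `D` gives
`char D.X = (gen)`, `ι gen = C(ϖ)·ι(L♯·h)`, so `1 ≤ ℓ_{𝔭₀} Λ/(L♯) ≤ ℓ_{𝔭₀} Λ/(L♯·h) = ℓ_{𝔭₀} Λ/(gen) = ℓ_{𝔭₀} D.X`
(`lengthAt_quotient_span_normalised_eq_of_natCast_p_not_mem`, `SkinnerUrban2014.lengthAt_eq_of_charIdeal_eq`); the dictionary
gives `1 ≤ ℓ_{ι𝔭₀} D′.X`; Kato's natural divisibility gives `ℓ_{ι𝔭₀} D′.X ≤ ℓ_{ι𝔭₀} Λ/(pⁿ·L♯) = ℓ_{ι𝔭₀} Λ/(L♯)`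
(`lengthAt_le_of_charIdeal_le`, `lengthAt_quotient_span_natCast_pow_mul_eq_of_not_mem`, `comap_invol_heightOne_not_mem`), hence
`L♯ ∈ ι𝔭₀`, i.e. `ι(L♯) ∈ 𝔭₀`; the X8 pair functional equation `ChromaticIota.ClassX8.mem_and_mem_iff_sharp_iotaPair` (R-221)
then puts `L♭ ∈ 𝔭₀` — contradiction. NOTHING about Sprung's conjecture is refuted: under the contragredient repair of the
leaf, hypothesis (ii) is the tree's own h716 and the chain compares `𝔭₀` with itself. [cite: Sprung2012, Thm. 7.16 (p. 1504),
Main Conj. 7.21 (p. 1505)] [cite: Sprung2017, Thm. 4.13 and Cor. 4.14] [cite: Kato2004Asterisque, Thm. 12.5 (p. 221)]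
[cite: MazurTateTeitelbaum1986Invent, Ch. I §17] -/
theorem SprungLowerDivisibilityAtThree_false_of_KeyedSharpPrivateZero :
    KeyedSharpPrivateZero →
      ¬ Summit.BirchSwinnertonDyer.BirchSwinnertonDyer.Theses.SignedLowerHalves.SprungLowerDivisibilityAtThree := by
  rintro ⟨W, hE, hGM, p, hp, hX, κ, γ, hκ, hγ, hcv, v, hv, g, hg, cneg, c, hH, N, hN, f, ϖ, Lsharp, Lflat, hf, hϖ, hSP,
    D, hDfin, hDt, D', hD'fin, hD't, ⟨n, hKato⟩, hdict, 𝔭₀, h𝔭₀, hp𝔭₀, hT𝔭₀, hΦ𝔭₀, hs𝔭₀, hf𝔭₀⟩ hK1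
  haveI : NeZero N := hN
  -- the typed leaf at the tree-keyed dual `D`
  have hs0 : chromaticL Chroma.sharp Lsharp Lflat ≠ 0 :=
    ChromaticBothColours.ClassX8.chromaticL_ne_zero W p hX f Lsharp Lflat hf hSP Chroma.sharp
  obtain ⟨gen, h, hchar, hgen⟩ :=
    hK1 W p hX Chroma.sharp κ γ hκ hγ hcv v hv g hg cneg c hH N hN f ϖ Lsharp Lflat hf hϖ hSP hs0 D
  rw [chromaticL_sharp] at hgen hs0
  have hϖ0 : ϖ ≠ 0 := hf.periodRatio_ne_zero hϖ
  have hgen0 : gen ≠ 0 := by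
    intro h0
    apply Module.charIdeal_ne_bot (IwasawaAlgebra p) D.X
    rw [← SharpFlatSelmerDualData.charIdeal, hchar, h0, Ideal.span_singleton_eq_bot]
  -- (1) `1 ≤ ℓ_{𝔭₀} Λ/(L♯) ≤ ℓ_{𝔭₀} Λ/(L♯·h) = ℓ_{𝔭₀} Λ/(gen) = ℓ_{𝔭₀} D.X`
  have hL1 : 1 ≤ Module.lengthAt (IwasawaAlgebra p) (IwasawaAlgebra p ⧸ Ideal.span {Lsharp}) 𝔭₀ := by
    rw [Order.one_le_iff_ne_zero, Ne, lengthAt_quotient_span_eq_zero_iff_not_mem Lsharp 𝔭₀]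
    exact fun hnot => hnot hs𝔭₀
  have hDgen : Module.lengthAt (IwasawaAlgebra p) D.X 𝔭₀ =
      Module.lengthAt (IwasawaAlgebra p) (IwasawaAlgebra p ⧸ Ideal.span {gen}) 𝔭₀ := by
    have hby := isTorsionBy_quotient_span_singleton (R := IwasawaAlgebra p) gen
    refine SkinnerUrban2014.lengthAt_eq_of_charIdeal_eq hDt
      (fun y ↦ ⟨⟨gen, mem_nonZeroDivisors_of_ne_zero hgen0⟩, @hby y⟩) ?_ 𝔭₀ h𝔭₀
    rw [Module.charIdeal_eq_span_of_lengthAt_eq_quotient hgen0 fun _ _ ↦ rfl, ← SharpFlatSelmerDualData.charIdeal]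
    exact hchar
  have hD1 : 1 ≤ Module.lengthAt (IwasawaAlgebra p) D.X 𝔭₀ := by
    rw [hDgen, lengthAt_quotient_span_normalised_eq_of_natCast_p_not_mem hϖ0 hgen 𝔭₀ hp𝔭₀,
      lengthAt_quotient_span_singleton_mul h hs0 𝔭₀]
    exact hL1.trans le_self_add
  -- (2) the dictionary: `1 ≤ ℓ_{ι𝔭₀} D′.X`
  rw [hdict 𝔭₀ h𝔭₀] at hD1
  -- (3) Kato's natural divisibility at `ι𝔭₀`: `ℓ_{ι𝔭₀} D′.X ≤ ℓ_{ι𝔭₀} Λ/(pⁿ L♯) = ℓ_{ι𝔭₀} Λ/(L♯)`, so `L♯ ∈ ι𝔭₀`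
  obtain ⟨h𝔮, hp𝔮⟩ := comap_invol_heightOne_not_mem 𝔭₀ h𝔭₀ hp𝔭₀
  have hpΛ : (p : IwasawaAlgebra p) ≠ 0 := by
    rw [← map_natCast (PowerSeries.C (R := ℤ_[p])) p]
    exact (IwasawaAlgebra.prime_C p).ne_zero
  have hx0 : (p : IwasawaAlgebra p) ^ n * Lsharp ≠ 0 := mul_ne_zero (pow_ne_zero n hpΛ) hs0
  have h3 : Module.lengthAt (IwasawaAlgebra p) D'.X (PrimeSpectrum.comap (invol p).toRingHom 𝔭₀) ≤
      Module.lengthAt (IwasawaAlgebra p)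
        (IwasawaAlgebra p ⧸ Ideal.span {(p : IwasawaAlgebra p) ^ n * Lsharp})
        (PrimeSpectrum.comap (invol p).toRingHom 𝔭₀) := by
    have hby := isTorsionBy_quotient_span_singleton (R := IwasawaAlgebra p) ((p : IwasawaAlgebra p) ^ n * Lsharp)
    refine SkinnerUrban2014.lengthAt_le_of_charIdeal_le
      (M := IwasawaAlgebra p ⧸ Ideal.span {(p : IwasawaAlgebra p) ^ n * Lsharp}) (N := D'.X)
      (fun y ↦ ⟨⟨_, mem_nonZeroDivisors_of_ne_zero hx0⟩, @hby y⟩) hD't ?_ _ h𝔮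
    rw [Module.charIdeal_eq_span_of_lengthAt_eq_quotient hx0 fun _ _ ↦ rfl, Ideal.span_singleton_le_iff_mem]
    exact hKato
  rw [lengthAt_quotient_span_natCast_pow_mul_eq_of_not_mem n Lsharp _ hp𝔮] at h3
  have hLι : Lsharp ∈ (PrimeSpectrum.comap (invol p).toRingHom 𝔭₀).asIdeal := by
    by_contra hnot
    have h0 := (lengthAt_quotient_span_eq_zero_iff_not_mem Lsharp
      (PrimeSpectrum.comap (invol p).toRingHom 𝔭₀)).mpr hnot
    rw [h0] at h3
    exact one_ne_zero (le_antisymm (hD1.trans h3) bot_le)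
  rw [PrimeSpectrum.comap_asIdeal, Ideal.mem_comap] at hLι
  change invol p Lsharp ∈ 𝔭₀.asIdeal at hLι
  rw [SignedKatoOffTwo.Invol.invol_eq_subst_invOnePlusSubOne] at hLι
  -- (4) the X8 pair functional equation: `L♯ ∈ 𝔭₀ ∧ ι(L♯) ∈ 𝔭₀ ⟹ L♭ ∈ 𝔭₀`
  exact hf𝔭₀ ((ChromaticIota.ClassX8.mem_and_mem_iff_sharp_iotaPair W p hX f hf Lsharp Lflat hSP 𝔭₀.asIdeal
    𝔭₀.isPrime hp𝔭₀ hT𝔭₀ hΦ𝔭₀).mpr ⟨hs𝔭₀, hLι⟩).2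

end Summit.BirchSwinnertonDyer.BirchSwinnertonDyer.Theorems

end
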